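import Summits.RiemannHypothesis.RiemannHypothesis.Theorems.HandoffDodgerTransform
import Summits.RiemannHypothesis.RiemannHypothesis.Theorems.HandoffDodgerLagrange
import HarnessLib

/-!
# HANDOFF — Lemma A1 of ATTEMPT-16 assembled: the dodger's transform is `(sin bξ/(bξ))·P(ξ²)/Λ_K(ξ²)` (rh-explicit, track «HANDOFF», seat prove-2 gen8)

HONEST FRAMING. Nothing here bears on the truth of RH; this is the kernel form of ATTEMPT-16 Lemma A1
(HOME/handoff/prove-2/ATTEMPT-16.md §2). For a real polynomial `P` with `P(0) = 1`, `deg P ≤ K` (in ATTEMPT-16,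
`P(u) = Π_{j≤K}(1 − u/z_j²)`, the polynomial killing the first `K` zeros of `ζ`), put
`a_k := (−1)^{k+1}·P(ℓ_k²)/(2Π_{m≠k}(1 − ℓ_k²/ℓ_m²))` (`ℓ_k = πk/b`). Then the cut-off cosine polynomial
`F(x) = (1/2b)(1 + 2Σ_k a_k cos(ℓ_k x))·1_{[−b,b]}` has
  `weilMellin F (½ + iξ) = (sin bξ/(bξ)) · P(ξ²)/Π_{k≤K}(1 − ξ²/ℓ_k²)`   (`ξ ∉ {0, ±ℓ_k}`)
— `weilMellin_cutoffCosPoly` (HandoffDodgerTransform) composed with the Lagrange identity `eval_div_prod_eq_one_sub_sum`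
(HandoffDodgerLagrange). This is the formula from which ATTEMPT-16 Lemma C bounds the dodger at every zero of `ζ`.
No `sorry`, standard axioms.

References: this track (ATTEMPT-16 §2). Folklore.
-/

set_option linter.dupNamespace false

noncomputable section

open Complex Polynomial Finset Literature.NumberTheory.LFunctions
open scoped Real

namespace Summit.RiemannHypothesis.RiemannHypothesis.Theorems.Handoff

/-- The squared lattice nodes `ν_k := ℓ_{k+1}²` (`k < K`), as complex numbers. [this track, ATTEMPT-16 §2] -/
def latticeNode (b : ℝ) (K : ℕ) (k : Fin K) : ℂ := ((latticeFreq b (k.val + 1)) ^ 2 : ℝ)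

/-- The nodes are non-zero for `b ≠ 0`. [folklore] -/
theorem latticeNode_ne_zero {b : ℝ} (hb : b ≠ 0) (K : ℕ) (k : Fin K) : latticeNode b K k ≠ 0 := by
  simp only [latticeNode, latticeFreq, ne_eq, Complex.ofReal_eq_zero]
  have : (π * ((k.val + 1 : ℕ) : ℝ) / b) ≠ 0 := by positivity
  exact pow_ne_zero 2 this

/-- The nodes are distinct. [folklore] -/
theorem latticeNode_injective {b : ℝ} (hb : 0 < b) (K : ℕ) : Function.Injective (latticeNode b K) := by
  intro i j h
  simp only [latticeNode, latticeFreq, Complex.ofReal_inj] at h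
  have hi : 0 ≤ π * ((i.val + 1 : ℕ) : ℝ) / b := by positivity
  have hj : 0 ≤ π * ((j.val + 1 : ℕ) : ℝ) / b := by positivity
  have h1 : π * ((i.val + 1 : ℕ) : ℝ) / b = π * ((j.val + 1 : ℕ) : ℝ) / b := (pow_left_inj₀ hi hj two_ne_zero).1 h
  have h2 : ((i.val + 1 : ℕ) : ℝ) = ((j.val + 1 : ℕ) : ℝ) := by
    have hπ : (π : ℝ) ≠ 0 := Real.pi_ne_zero
    field_simp at h1
    linarith
  exact Fin.ext (by exact_mod_cast (Nat.succ_injective (by exact_mod_cast h2) : i.val = j.val))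

/-- **ATTEMPT-16 Lemma A1 (kernel): the dodger's transform.** Let `P ∈ ℝ[X]` with `P(0) = 1`, `deg P ≤ K`, `b > 0`, and let the
coefficients satisfy `a_{k+1} = (−1)^k·P(ℓ_{k+1}²)/(2Π_{m≠k}(1 − ℓ_{k+1}²/ℓ_{m+1}²))` (`k < K`). Then for `ξ ∉ {0, ±ℓ_1, …, ±ℓ_K}`,
`weilMellin (cutoffCosPoly b K a) (½ + iξ) = (sin bξ/(bξ))·P(ξ²)/Π_{k<K}(1 − ξ²/ℓ_{k+1}²)` with `P` read in `ℂ[X]`.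
[this track, ATTEMPT-16 Lemma A1] -/
theorem weilMellin_cutoffCosPoly_eq_div {b : ℝ} (hb : 0 < b) (K : ℕ) (P : ℝ[X]) (hP0 : P.eval 0 = 1)
    (hdeg : P.natDegree ≤ K) (a : ℕ → ℝ)
    (ha : ∀ k : Fin K, ((a (k.val + 1) : ℝ) : ℂ) =
      (-1) ^ k.val * (P.map (algebraMap ℝ ℂ)).eval (latticeNode b K k) /
        (2 * ∏ m ∈ univ.erase k, (1 - latticeNode b K k / latticeNode b K m)))
    {ξ : ℂ} (hξ : ξ ≠ 0)
    (hξ1 : ∀ k ∈ Finset.range K, ξ + latticeFreq b (k + 1) ≠ 0)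
    (hξ2 : ∀ k ∈ Finset.range K, ξ - latticeFreq b (k + 1) ≠ 0) :
    weilMellin (cutoffCosPoly b K a) (1 / 2 + I * ξ) =
      Complex.sin (b * ξ) / (b * ξ) *
        ((P.map (algebraMap ℝ ℂ)).eval (ξ ^ 2) / ∏ k : Fin K, (1 - ξ ^ 2 / latticeNode b K k)) := by
  rw [weilMellin_cutoffCosPoly hb K a hξ hξ1 hξ2]
  congr 1
  -- the Lagrange identity at u = ξ²
  set Pc : ℂ[X] := P.map (algebraMap ℝ ℂ) with hPc
  have hPc0 : Pc.eval 0 = 1 := by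
    rw [hPc, eval_map, ← map_zero (algebraMap ℝ ℂ), eval₂_at_apply, hP0, map_one]
  have hPdeg : Pc.natDegree ≤ K := natDegree_map_le.trans hdeg
  have hu : ∀ k : Fin K, ξ ^ 2 ≠ latticeNode b K k := by
    intro k h
    have hk : k.val ∈ Finset.range K := Finset.mem_range.2 k.isLt
    have : (ξ + latticeFreq b (k.val + 1)) * (ξ - latticeFreq b (k.val + 1)) = 0 := by
      rw [← sq_sub_sq, h]
      simp [latticeNode]
    rcases mul_eq_zero.1 this with h1 | h2
    · exact hξ1 k.val hk h1
    · exact hξ2 k.val hk h2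
  have hL := eval_div_prod_eq_one_sub_sum (latticeNode b K) (latticeNode_injective hb K) (latticeNode_ne_zero hb.ne' K)
    Pc hPc0 hPdeg (ξ ^ 2) hu
  rw [hL, Finset.sum_range (fun k ↦ (-1) ^ (k + 1) * (a (k + 1) : ℂ) *
    (ξ ^ 2 / (ξ ^ 2 - (latticeFreq b (k + 1) : ℂ) ^ 2))), sub_eq_add_neg, ← Finset.sum_neg_distrib, Finset.mul_sum]
  congr 1
  refine Finset.sum_congr rfl fun k _ ↦ ?_
  rw [ha k]
  have hnode : (latticeNode b K k : ℂ) = (latticeFreq b (k.val + 1) : ℂ) ^ 2 := by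
    simp [latticeNode]
  rw [hnode]
  have hprod : (∏ m ∈ univ.erase k, (1 - latticeNode b K k / latticeNode b K m)) ≠ 0 := by
    rw [Finset.prod_ne_zero_iff]
    intro m hm
    have hmk : m ≠ k := ne_of_mem_erase hm
    have : latticeNode b K k / latticeNode b K m ≠ 1 := by
      intro h
      rw [div_eq_one_iff_eq (latticeNode_ne_zero hb.ne' K m)] at h
      exact hmk ((latticeNode_injective hb K) h).symm
    exact sub_ne_zero.2 (Ne.symm this)
  rw [hnode] at hprod
  rcases neg_one_pow_eq_or ℂ k.val with h | h
  · rw [pow_succ, h]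
    field_simp
  · rw [pow_succ, h]
    field_simp

end Summit.RiemannHypothesis.RiemannHypothesis.Theorems.Handoff
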